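import Summits.SmoothPoincare4.SmoothPoincare4.Theses.CutLocusSpine
import Summits.SmoothPoincare4.SmoothPoincare4.Theses.NoOneHandles
import Literature.Geometry.Riemannian.CutLocus

/-!
# Birth skeleton for crux `CutLocusSpine.MultiplicityFour` (stmt-SmoothPoincare4-11118)

planner-skel-stmt-SmoothPoincare4-11118-0 · skeleton-register (BC3, one-shot) · 2026-08-17.
Route `route-SmoothPoincare4-CutLocusSpine` (rev 2), crux #2 (rank 2, OPEN / open-problem): every
homotopy 4-sphere `(M, e : M ≃ₕ S⁴)` (the summit's own binders) carries a smooth Riemannian metric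
`g` and a point `p` whose metric cut locus `Cut_g(p)` is (i) the homeomorphic image of a finite
simplicial complex and (ii) COMBED: every `q` is joined to `p` by at most four minimal geodesics
(midpoint count `N(q) ≤ 4`; no quintuple `A₁⁵` points; the card's `c_cut(M) = 0`).

## The line — HANDLES WITHOUT INDEX ONE, THEN A METRIC THAT CUTS ALONG THE HANDLE WALLS

`c_cut = 0` is the Riemannian shadow of Martelli's PL complexity zero (arXiv:0810.5478: `c(M)` =
least number of vertices of a simple spine; Cor. 15.5: a closed 4-manifold with a handle
decomposition WITHOUT 3-HANDLES has `c = 0`; §15.3: "it is still unknown whether every simply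
connected 4-manifold has a handle decomposition without 3-handles"; §3 p. 11: for a 0–2–4
decomposition the union `P` of the boundaries of the handles is a simple spine without vertices,
"all points are of type 3 or 2"). Reading a 1-handle-free Morse function `f` downward from a
maximum `p`, the complement `W = M ∖ h⁴(p)` is built on its boundary sphere from RELATIVE handles of
index `4 − 3 = 1`, `4 − 2 = 2`, `4 − 4 = 0` and `4 − 0 = 4` — none of index 3 — and the union `P₀`
of the relative handle boundaries is a compact 3-polyhedron with
`W ∖ P₀ = ∂W × [0,1) ⊔ (one open 4-ball per handle)` whose points see 2, 3 or 4 local regions: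
2 across a handle wall, 3 along the boundary of an attaching region (the spheres `S⁰ × S²` of the
relative 1-handles, the tori `∂(S¹ × D²)` of the relative 2-handles), 4 along the circles where an
attaching torus crosses a sphere `S⁰ × S²` — and NEVER 5: a 5-fold point needs THREE families of
attaching-region boundaries meeting, and the third family (the spheres `S² × S⁰` of relative
3-handles = index-1 critical points of `f`) is absent. Deleting one small open 3-disc from a wall
between the collar region and each handle ball in turn (Martelli §7.2) merges all balls into the
collar: `P = P₀ ∖ ⋃ D̊ᵢ` has `M ∖ P ≅` open 4-ball `∋ p`, local side-counts `ν ∈ {1,2,3,4}` (`1` on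
the new free 2-spheres `∂Dᵢ`). The bet of the line (stub S2) is the METRIC REALISATION of such a
`P` as `Cut_g(p)` with `N = ν`: Weinstein 1968 Prop. C (quoted as Lemma 2.3 of Itoh–Vîlcu,
arXiv:1103.1759, in every dimension `d`: a metric on `M`, unchanged near `M ∖ D̊`, for which `exp_p`
is a diffeomorphism of the unit tangent disc onto the 4-disc `D = h⁴`) reduces it to a metric on `W`
whose BOUNDARY cut locus is `P` — a "Riemannian `P`-strip" three dimensions up from Itoh–Vîlcu's
Thm. 2.6 ("every graph is a cut locus", built from strips + Weinstein's lemma) and from J. Itoh 1984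
(Adv. Stud. Pure Math. 3: for a Morse function on a surface with one minimum and no saddle
connection, some metric makes the union of the unstable manifolds of the positive-index critical
points a cut locus) — the free faces `∂Dᵢ` being fold (`A₃`) edges as on the 4-ellipsoid
(Itoh–Kiyohara 2010 Thm. 7.1: `Cut = D³`, `N = 2` inside, `1` on `∂D³`). Itoh–Vîlcu Question 2.9
(iii) ("Can Theorem 2.6 be extended to higher dimensions?") is exactly S2's open part.

The topological input is stub S1, BY NAME the crux `NoohNoOneHandles` of route NoOneHandles
(stmt-SmoothPoincare4-0378, open; Kirby Problem 4.18 restricted to homotopy 4-spheres): every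
homotopy 4-sphere admits a Morse function without index-1 critical points. So the line records
`MultiplicityFour ⇐ (Kirby 4.18)|_Σ + (every 1-handle-free closed 4-manifold has c_cut = 0)`:
the ∃-half of the cut-locus ladder is AT MOST as hard as removing 1-handles, and its properly
Riemannian content (S2) is a construction problem stated for ALL closed connected 4-manifolds, with
no homotopy-sphere hypothesis — not the crux reworded.

Stub set (2): S1 `stub_noOneHandles` (OPEN, famous; shared item 0378) · S2 `stub_handleCutLocus`
(OPEN but constructive, XL; hardest stub OWNED by this line). Composition
`MultiplicityFour_of : S1 → S2 → MultiplicityFour` (hypotheses spelled through the name-keyed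
aliases `__Registered.stub_*`, definitionally S1–S2) is kernel-checked: from the summit binders
`(M, e)` it PROVES compactness (`compactSpace_of_homotopyEquiv_sphere_four_holds`, Hatcher 3.29),
simple connectivity hence connectedness (`simplyConnectedSpace_sphere_four_holds` +
`HomotopyEquiv.simplyConnectedSpace`) and orientability
(`isOrientable_of_homotopyEquiv_sphere_four_holds`, Lee 15.43), packages `⟨M, o, ⟨e⟩⟩ :
HomotopySphere 4` for S1, and feeds the Morse function to S2; the conclusion of S2 is stated over
the tree's `cutLocus` / `minimalGeodesicMultiplicity` (`CutLocus.lean`), which are DEFINITIONALLY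
the crux's inline sets (refuter read-backs 2026-08-15, `Iff.rfl`).

Disproof.lean: none exists for this crux (`ledger crux ls stmt-SmoothPoincare4-11118`: no
workfiles, 2026-08-17) — no `_false_without_<H>` obligation to honour. Negatives index
(`ledger negatives --problem SmoothPoincare4`): 0 refuted statements. Landed `Theorems/*/Negative/*`
of the sub concern other cruxes (ZseThesis, …); neither stub is an instance of one. Barriers
(route header): PropertyTwoR / StrictPropertyTwoR bite only on handle-slide attacks on a
2-handlebody presentation — S1 asserts the EXISTENCE of a 1-handle-free structure (Kirby 4.18; the
only known obstructions, Yasui's, need `b₂⁺ > 1`) and S2 slides nothing; TwistedSphere / OpenAnalogue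
/ HCobordism / Contractible barriers concern recognition (the route's RungFour side), not this
∃-half. Cheapest falsifier of S2: a closed 1-connected 4-manifold with a 0–2–4 handle structure
(e.g. `CP²`, `S² × S²`) on which NO metric has a combed (`N ≤ 4`) triangulable cut locus — the line
predicts `N ≤ 3` there (walls `S³ ∪ solid tori`, punctured).
-/

noncomputable section

set_option linter.dupNamespace false

namespace Summit.SmoothPoincare4.SmoothPoincare4.Cruxes.MultiplicityFour.Birth

open scoped Manifold ContDiff Topology ENNReal
open Literature.Geometry.Lorentzian (PseudoRiemannianMetric)
open Literature.Geometry.Riemannian (cutLocus minimalGeodesicMultiplicity)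
open Literature.Topology.FourManifolds (IsMorse criticalSetOfIndex HomotopySphere)
open Summit.SmoothPoincare4.SmoothPoincare4.Theses.CutLocusSpine (MultiplicityFour)
open Summit.SmoothPoincare4.SmoothPoincare4.Theses.NoOneHandles (NoohNoOneHandles)

/-- Local notation: the model space `ℝ⁴`. -/
local notation "ℝ⁴" => EuclideanSpace ℝ (Fin 4)

/-! ## Vocabulary (definitional abbreviations of the crux's own clauses) -/

section Vocabulary

variable {M : Type*} [TopologicalSpace M] [ChartedSpace ℝ⁴ M] [IsManifold (𝓡 4) ∞ M]

/-- **Combed cut locus data at `(g, p)`** — verbatim clauses (i) ∧ (ii) of the crux, over the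
tree's names: (i) the metric cut locus `cutLocus g hg p` is the homeomorphic image of (the space
of) a finite simplicial complex realised in some `ℝᵏ`; (ii) every point `q` has minimal-geodesic
multiplicity (midpoint count) `≤ 4` as seen from `p`. -/
def IsCombedCutPair (g : PseudoRiemannianMetric (𝓡 4) ∞ ℝ⁴ (TangentSpace (𝓡 4) : M → Type _))
    (hg : g.IsRiemannian) (p : M) : Prop :=
  (∃ (k : ℕ) (K : Geometry.SimplicialComplex ℝ (EuclideanSpace ℝ (Fin k))) (φ : K.space → M),
      K.faces.Finite ∧ Topology.IsEmbedding φ ∧ Set.range φ = cutLocus g hg p) ∧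
    ∀ q : M, minimalGeodesicMultiplicity g hg p q ≤ 4

/-- The vocabulary is DEFINITIONALLY the crux's matrix: `cutLocus` and
`minimalGeodesicMultiplicity` unfold to the crux's inline sets. -/
theorem isCombedCutPair_iff (g : PseudoRiemannianMetric (𝓡 4) ∞ ℝ⁴ (TangentSpace (𝓡 4) : M → Type _))
    (hg : g.IsRiemannian) (p : M) :
    IsCombedCutPair g hg p ↔
      (∃ (k : ℕ) (K : Geometry.SimplicialComplex ℝ (EuclideanSpace ℝ (Fin k))) (φ : K.space → M),
          K.faces.Finite ∧ Topology.IsEmbedding φ ∧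
            Set.range φ = {q : M | q ≠ p ∧ ∀ r : M, g.edist hg p r = g.edist hg p q + g.edist hg q r → r = q}) ∧
        ∀ q : M, ({m : M | g.edist hg p m = g.edist hg m q ∧
          g.edist hg p m + g.edist hg m q = g.edist hg p q}).encard ≤ 4 :=
  Iff.rfl

end Vocabulary

/-! ## The stub statements -/

/-- **S2 — REALISATION: A 1-HANDLE-FREE CLOSED 4-MANIFOLD HAS A COMBED TRIANGULABLE CUT LOCUS
(`c_cut = 0`).** For every compact connected Hausdorff second-countable smooth 4-manifold `M`
(no homotopy-sphere hypothesis) and every Morse function `f : M → ℝ` without critical points of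
index 1, there exist a smooth Riemannian metric `g` and a point `p` whose metric cut locus is the
homeomorphic image of a finite simplicial complex and has minimal-geodesic multiplicity `≤ 4`
everywhere. (The Riemannian form of Martelli's Cor. 15.5 "no 3-handles ⇒ complexity zero", read
through `−f`; the dimension-4 case of Itoh–Vîlcu's Question 2.9 (iii) for the handle-wall
polyhedron; J. Itoh 1984 is the dimension-2 prototype "Morse function ⇒ metric whose cut locus is
the Morse spine".) -/
def HandleCutLocusRealisation : Prop :=
  ∀ (M : Type) [TopologicalSpace M] [T2Space M] [SecondCountableTopology M] [CompactSpace M]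
    [ConnectedSpace M] [ChartedSpace ℝ⁴ M] [IsManifold (𝓡 4) ∞ M] (f : M → ℝ),
    IsMorse (𝓡 4) f → criticalSetOfIndex (𝓡 4) f 1 = ∅ →
    ∃ (g : PseudoRiemannianMetric (𝓡 4) ∞ ℝ⁴ (TangentSpace (𝓡 4) : M → Type _))
      (hg : g.IsRiemannian) (p : M), IsCombedCutPair g hg p

/-! ## The stubs S1–S2 (the only `sorry`s of the file) -/

/-- **S1 `stub_noOneHandles`** — OPEN (Kirby Problem 4.18 restricted to homotopy 4-spheres); BY NAME
the crux `NoohNoOneHandles` of route NoOneHandles (item stmt-SmoothPoincare4-0378, open, refuter- and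
grounder-stamped): every `HomotopySphere 4` (compact oriented smooth 4-manifold homotopy equivalent
to `S⁴`) admits a Morse function `f` with `criticalSetOfIndex (𝓡 4) f 1 = ∅`, i.e. a handle
decomposition without 1-handles. WHY IT MIGHT HOLD: true in every dimension `≠ 4` for simply
connected manifolds (Martelli §12: dimension 3 by Perelman, `≥ 5` by handle trading); in dimension
4 no obstruction is known on homotopy spheres (the known obstructions to removing 1-handles —
Yasui's, via stable cohomotopy Seiberg–Witten invariants — need `b₂⁺ > 1`), and 1- and 3-handle trading
works topologically (Freedman). WHY IT MIGHT FAIL (= route NoOneHandles' note on C1): trading needs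
smoothly embedded 2-discs; an exotic `S⁴` all of whose decompositions need 1-handles refutes it.
A proof of S1 closes item 0378 as well (same constant). Size: OPEN. Leans on:
`Literature.Topology.FourManifolds.IsMorse`, `criticalSetOfIndex`, `HomotopySphere`.
[Kirby1997 Problem 4.18; GompfStipsicz1999 §5.1; Yasui2019 Thm 1.4; arXiv:0810.5478 §12, §15.3.] -/
theorem stub_noOneHandles : NoohNoOneHandles := by
  sorry

/-- **S2 `stub_handleCutLocus`** — OPEN but constructive, size XL; the stub this line OWNS (hardest
here). Statement: `HandleCutLocusRealisation`. WHY PLAUSIBLY TRUE (proof plan):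
(a) HANDLES. `f` Morse without index-1 critical points gives (Smale rearrangement, Milnor 1965
Thm. 4.8) a handle decomposition of `M` with handles of index 0, 2, 3, 4 only; let `p` be the centre
of a 4-handle `D = h⁴` and `W = M ∖ D̊`, `∂W ≅ S³`. Read from `∂W` inward (i.e. along `−f`), `W` is
`∂W × I` plus RELATIVE handles of index 1 (the index-3 points), 2 (index-2 points), 0 (other
maxima) and 4 (the minima) — no relative 3-handles.
(b) WALLS. `P₀ :=` the union of the boundaries of the relative handles (Martelli, arXiv:0810.5478,
p. 11 for the 0–2–4 case; Thm. "handles" §8.2 and Cor. 15.5): a compact 3-polyhedron, `W ∖ P₀ =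
∂W × [0,1) ⊔` (one open 4-ball per relative handle), smoothable stratum by stratum (PL = DIFF in
dimension 4). Local side-count `ν`: 2 across a wall; 3 along the boundary of an attaching region —
the spheres `S⁰ × S²` of relative 1-handles, the tori `∂(S¹ × D²)` of relative 2-handles (and the
`S³` of an extra relative 0-handle); 4 along the transverse circles (torus ∩ sphere) where an
attaching circle runs over a relative 1-handle; never 5, because 5 regions at a point need three
boundary-of-attaching-region surfaces through it and distinct tori (resp. distinct spheres) are
disjoint — the third family, the spheres `S² × S⁰` of relative 3-handles, is what index-1 critical
points of `f` would contribute (with all indices present a 3-handle attaching sphere generically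
meets the quadruple circles in isolated 5-fold points: Martelli's vertices).
(c) ONE BALL. Along a spanning tree of the ball-adjacency graph rooted at the collar, delete from a
wall between the current collar region and the next ball one small open 3-disc `D̊ᵢ` (Martelli §7.2,
proof of `c^alm_str = c^alm`: "removing a small open (n−1)-ball … one ball less"): gluing a 4-ball
to `S³ × [0,1)` along a boundary 3-disc returns `S³ × [0,1)`, so `P := P₀ ∖ ⋃ D̊ᵢ` has
`W ∖ P ≅ ∂W × [0,1)`, `M ∖ P ≅` open 4-ball, `ν ∈ {1,2,3,4}` (`ν = 1` exactly on the free
2-spheres `∂Dᵢ`), and `P` is a finite polyhedron (triangulable: clause (i)).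
(d) METRIC. Realise `P` as a BOUNDARY cut locus: a smooth metric `g_W` on `W`, product near `∂W`
with round `∂W`, whose inward normal geodesics from `∂W` minimise exactly until they reach `P`,
`ν(q)` of them ending at `q ∈ P` — built from the local models: Fermi/bisector charts across walls
(two sheets of the wavefront meeting head-on), Voronoi-type corners along triple surfaces and
quadruple circles (three / four smooth branch distance functions `dᵢ` with `|∇dᵢ| = 1` whose
pairwise bisectors are the given sheets — the sheet conormals of a smooth simple polyhedron at a
`ν`-fold stratum are automatically differences `uᵢ − uⱼ` of `ν` unit vectors, the compatibility
being the coplanarity of the three conormals at each triple surface), and the FOLD model of the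
ellipsoid at the free faces (Itoh–Kiyohara 2010 Thm. 7.1: `Cut = D³`, two minimal geodesics to
interior points, one — conjugate, `A₃` — to boundary points); then Weinstein 1968 Prop. C (= Lemma
2.3 of Itoh–Vîlcu, any dimension) caps `W` with the disc `D ∋ p` by a metric for which `exp_p` is a
diffeomorphism of the unit tangent disc onto `D`, unchanged near `W`: the minimal geodesics from `p`
are the radii followed by the inward normal geodesics of `∂W`, so `Cut_g(p) = C(∂W ⊂ W) = P` and
`N(q) = ν(q) ≤ 4` (midpoints ↔ minimal geodesics on a compact manifold, `CutLocus.lean` docstring;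
`N(p) = 1`, `N = 1` off `P ∪ {p}`). This is Itoh–Vîlcu's scheme (strip + Weinstein's lemma, Prop.
2.4 (iii)⇒(i)) three dimensions up, and J. Itoh 1984's theorem (Morse function ⇒ cut-locus metric,
dimension 2) one rung of indices up; their Question 2.9 (iii) asks for exactly such extensions.
WHY IT MIGHT FAIL: step (d) — smoothing the corners of the wavefront family near quadruple circles
while keeping EVERY inward normal geodesic minimising up to `P` (no earlier cut/conjugate point) is
a genuine global ODE/comparison problem in dimension 4 (Itoh–Vîlcu do it by explicit flat strips in
dimension 2); a hidden focal point before `P` would change the cut locus. CHEAPEST FALSIFIER: the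
0–2–4 manifolds `CP²`, `S² × S²` (predicted `N ≤ 3`: walls `S³ ∪` solid tori, punctured) — any
obstruction to a combed cut locus there kills S2 at once; in Lean, the degenerate instance `M = S⁴`,
`f` = height (indices 0, 4) must reproduce the ellipsoid picture (`P = S³` punctured once `= D³`,
`N ≤ 2`: Itoh–Kiyohara). Leans on: `Literature.Geometry.Riemannian.cutLocus`,
`minimalGeodesicMultiplicity`, `WeinsteinCutLocus`/`WeinsteinCriterion` (Weinstein's step (4) is in
tree), `ExpMap*`, `CutTimeCutLocus`, `CutLocusBishop*` (cut locus = closure of `{N ≥ 2}`),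
`Literature.Topology.FourManifolds.Morse` (`IsMorse.exists_chart_eq_quadratic`, unproved fact),
Mathlib `Geometry.SimplicialComplex`. [Weinstein1968 Prop. C; arXiv:1103.1759 Lemma 2.3, Prop. 2.4,
Thm. 2.6, Question 2.9 (iii); Itoh1984 (Adv. Stud. Pure Math. 3, 29–46); arXiv:0810.5478 p. 11,
§7.2, §8.2, Cor. 15.5; ItohKiyohara2010 Thm. 7.1 (arXiv:0904.4743); Buchner1977Simplicial;
Bishop1977; Milnor1965 Thm. 4.8.] -/
theorem stub_handleCutLocus : HandleCutLocusRealisation := by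
  sorry

/-! ## Name-keyed aliases of the two statements — the hypotheses of `MultiplicityFour_of`

The native skeleton audit (`#h21_check_skeleton`, run by `ledger skeleton check`) admits a hypothesis
of the composing theorem only if its head constant is a registered obligation or is NAMED like a
declared stub; `__Registered.stub_X` is statement `X` under the registered stub's short name (device
of `AnomalousDissipation/…/Cruxes/MirrorFloorTG/Lines/birth.lean`). Each alias is an `abbrev`,
definitionally its statement; `NoohNoOneHandles` is itself a registered route item, aliased only for
uniformity. -/
namespace __Registered

/-- Alias of `NoohNoOneHandles` keyed by the registered stub name. -/
abbrev stub_noOneHandles : Prop := NoohNoOneHandles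
/-- Alias of `HandleCutLocusRealisation` keyed by the registered stub name. -/
abbrev stub_handleCutLocus : Prop := HandleCutLocusRealisation

end __Registered

/-! ## Proved: the composition -/

/-- **`MultiplicityFour` from the two stub statements.** Given the summit binders `(M, e)`: `M` is
compact (Hatcher 3.29, proved fact), simply connected (transport of `π₁(S⁴) = 0`, proved fact) hence
connected, and orientable (Lee 15.43, proved fact), so `⟨M, o, ⟨e⟩⟩` is a `HomotopySphere 4`; S1
hands over a Morse function without index-1 critical points on `M`, and S2 turns it into a metric
and a point with a combed triangulable cut locus — definitionally the crux's matrix. -/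
theorem MultiplicityFour_of :
    __Registered.stub_noOneHandles → __Registered.stub_handleCutLocus → MultiplicityFour := by
  intro h1 h2 M _ _ _ _ _ e
  haveI : CompactSpace M :=
    Literature.Topology.FourManifolds.compactSpace_of_homotopyEquiv_sphere_four_holds M e
  haveI : SimplyConnectedSpace (Metric.sphere (0 : EuclideanSpace ℝ (Fin 5)) 1) :=
    Literature.Topology.FourManifolds.simplyConnectedSpace_sphere_four_holds
  haveI : SimplyConnectedSpace M := e.simplyConnectedSpace
  obtain ⟨o⟩ :=
    Literature.Topology.FourManifolds.isOrientable_of_homotopyEquiv_sphere_four_holds M e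
  obtain ⟨f, hf, h1f⟩ := h1 ⟨M, o, ⟨e⟩⟩
  obtain ⟨g, hg, p, hP⟩ := h2 M f hf h1f
  exact ⟨g, hg, p, (isCombedCutPair_iff g hg p).1 hP⟩

/-- WIRING CHECK: the two sorried stubs compose to a closed term of the crux's type (modulo their
`sorry`s). Deliberately an `example` (no constant enters the environment), so that a BC3 probe
importing this file cannot close `stub → MultiplicityFour` by `exact?` through a pre-composed
witness. -/
example : MultiplicityFour :=
  MultiplicityFour_of stub_noOneHandles stub_handleCutLocus

end Summit.SmoothPoincare4.SmoothPoincare4.Cruxes.MultiplicityFour.Birth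

end
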